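import Literature.NumberTheory.Automorphic.DiscreteAutomorphicRepArchModule
import Literature.NumberTheory.Automorphic.DiscreteSummandProjection
import HarnessLib

/-!
# Bounded intertwiners and the Harish-Chandra module: transport of smooth vectors, `K`-finite vectors and the differential

Topic `NumberTheory/Automorphic`; namespace `Literature.NumberTheory.Automorphic` (section `Intertwiner`; dot notation on
`DiscreteAutomorphicRep` in §3).  THEOREMS plus ONE light definition with body (`Intertwiner.harishChandraMap`, the induced map of
Harish-Chandra spaces); no named fact, no instance, no notation, no `sorry`.

Let `G` be a linear real group (`RealMatrixGroup A N`, ★ `RealMatrixGroups`), `π`, `π'` representations of `G` by bounded operators on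
complex normed spaces `H`, `H'` (`ContRepresentation`), and `T : H →L[ℂ] H'` a BOUNDED INTERTWINER: `T (π g v) = π' g (T v)`.  Then
(Wallach, *Real Reductive Groups I*, §1.6.1–1.6.2 and §3.3.3–3.3.4; Borel–Wallach, 0 §2.4 and §3.1: «a continuous intertwining operator maps
`V^∞` to `V'^∞`, `V_(K)` to `V'_(K)`, and commutes with the derived actions»; Harish-Chandra 1953, §9):

* §1 `Intertwiner.orbit_eq` — the `exp`-orbit map of `T v` is `T ∘` that of `v` (★ `ExpOrbit.orbit`); hence `T` maps smooth vectors to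
  smooth vectors (`map_mem_smoothVectors`), `K`-finite vectors to `K`-finite vectors (`kOrbitSpan_map`, `map_mem_kFiniteVectors`), the
  Harish-Chandra space `H_K^∞` to `H'_K^∞` (`map_mem_harishChandraSpace`), and COMMUTES WITH THE DIFFERENTIAL: `dπ'(X)(T v) = T (dπ(X) v)`
  for every vector `v` with differentiable orbit (`dπ_map`, uniqueness of derivatives; ★ `hasDerivAt_dπ`).
* §2 `Intertwiner.harishChandraMap` — the induced `ℂ`-linear map `H_K^∞ → H'_K^∞`; it intertwines the `K`-actions ★ `harishChandraRepK`
  (`harishChandraMap_repK`) and, for strongly continuous `π`, `π'` on Banach spaces, the `𝔤`-actions ★ `harishChandraRepLie`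
  (`harishChandraMap_repLie`): a bounded intertwiner induces a `(𝔤, K)`-map of Harish-Chandra modules; `harishChandraMap_apply_ne_zero`.
* §3 The archimedean module of a discrete automorphic representation (★ `DiscreteAutomorphicRepArchModule`): a bounded operator `T` on
  `P.space` commuting with `P.archRep G ιG` maps `P.archModule G ιG` to itself and intertwines `P.archRepK`, `P.archRepLie`
  (`DiscreteAutomorphicRep.map_mem_archModule`, `…archRepK_map`, `…archRepLie_map`); the orthogonal projection onto a CLOSED
  `P.archRep`-invariant subspace is such an operator (`DiscreteAutomorphicRep.starProjection_archRep`, from unitarity ★ `isUnitary_archRep` and ★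
  `ClosedSubrep.starProjection_map_apply`, [Dixmier1977, §13.1.2]) — the tool by which a closed `G_ι`-invariant subspace of `P` DETECTS vectors
  of the archimedean `(𝔤, K)`-module by a `(𝔤, K)`-map (cell hodgecm-mathlib, road «F1a in-house at the pin», brick B2).

## References

* N. R. Wallach, *Real Reductive Groups I* (1988), §1.6.1–1.6.2, §3.3.3–3.3.4 [WallachRRG1].
* A. Borel, N. Wallach, *Continuous Cohomology, Discrete Subgroups, and Representations of Reductive Groups*, 2nd ed. (2000), 0 §2.4, §3.1
  [BorelWallach2000].
* Harish-Chandra, Trans. AMS 75 (1953), §9 [HarishChandra1953].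
* J. Dixmier, *C\*-algebras* (1977), §13.1.2 [Dixmier1977].
-/

-- Mathlib idiom (Mathlib/Algebra/Lie/OfAssociative.lean; as in ★ `GKModules` and every `(𝔤, K)` file of the tree):
-- the commutator bracket on `Module.End ℂ V`, needed to MENTION `G.lie →ₗ⁅ℝ⁆ Module.End ℂ _`.
attribute [local instance 100] LieRing.ofAssociativeRing

open MeasureTheory
-- the operator-norm structure on matrices, under which `G.lie.toSubmodule` is a normed space (as in ★ `GKModulesSmoothVectorsProofs`)
open scoped Matrix.Norms.Operator

noncomputable section

namespace Literature.NumberTheory.Automorphic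

/-! ## §1 Transport of smooth vectors, `K`-finite vectors and the differential along a bounded intertwiner -/

namespace Intertwiner

variable {A : Type*} [NormedCommRing A] [NormedAlgebra ℝ A] [NormedAlgebra ℚ A] [CompleteSpace A]
  [StarRing A] {N : Type*} [Fintype N] [DecidableEq N] (G : RealMatrixGroup A N)
  {H : Type*} [NormedAddCommGroup H] [NormedSpace ℂ H] {H' : Type*} [NormedAddCommGroup H'] [NormedSpace ℂ H']
  {π : ContRepresentation ℂ G.carrier H} {π' : ContRepresentation ℂ G.carrier H'} {T : H →L[ℂ] H'}

/-- The `exp`-orbit map of `T v` under `π'` is `T ∘` the `exp`-orbit map of `v` under `π`. [cite: WallachRRG1, §1.6.1] -/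
theorem orbit_eq (hT : ∀ (g : G.carrier) (v : H), T (π g v) = π' g (T v)) (v : H) :
    ExpOrbit.orbit G (realRep G π') (T v) = fun Y => T (ExpOrbit.orbit G (realRep G π) v Y) := by
  funext Y
  rw [ExpOrbit.orbit_apply, ExpOrbit.orbit_apply, realRep_apply, realRep_apply, hT]

/-- **A bounded intertwiner maps smooth vectors to smooth vectors.** [cite: WallachRRG1, §1.6.2] [cite: BorelWallach2000, 0 §3.1] -/
theorem map_mem_smoothVectors (hT : ∀ (g : G.carrier) (v : H), T (π g v) = π' g (T v)) {v : H}
    (hv : v ∈ smoothVectors G π) : T v ∈ smoothVectors G π' := by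
  rw [mem_smoothVectors_iff_contDiff_orbit, orbit_eq G hT]
  exact (T.restrictScalars ℝ).contDiff.comp (contDiff_of_mem_smoothVectors G π hv)

/-- A vector with differentiable `exp`-orbit is mapped to one (chain rule). [cite: WallachRRG1, §1.6.1] -/
theorem differentiableAt_orbit_map (hT : ∀ (g : G.carrier) (v : H), T (π g v) = π' g (T v)) {v : H}
    (hv : DifferentiableAt ℝ (ExpOrbit.orbit G (realRep G π) v) 0) :
    DifferentiableAt ℝ (ExpOrbit.orbit G (realRep G π') (T v)) 0 := by
  rw [orbit_eq G hT]
  exact DifferentiableAt.comp (0 : G.lie.toSubmodule) (T.restrictScalars ℝ).differentiableAt hv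

/-- **The orbit span is transported**: the span of the `K`-orbit of `T v` is the image under `T` of the span of the `K`-orbit of `v`.
[cite: WallachRRG1, §3.3.3] -/
theorem kOrbitSpan_map (hT : ∀ (g : G.carrier) (v : H), T (π g v) = π' g (T v)) (v : H) :
    kOrbitSpan G π' (T v) = (kOrbitSpan G π v).map (T : H →ₗ[ℂ] H') := by
  have h : (fun k : G.maximalCompact => π' (Subgroup.inclusion G.maximalCompact_le_carrier k) (T v)) =
      ⇑(T : H →ₗ[ℂ] H') ∘ fun k : G.maximalCompact => π (Subgroup.inclusion G.maximalCompact_le_carrier k) v :=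
    funext fun k => (hT _ v).symm
  rw [kOrbitSpan, kOrbitSpan, Submodule.map_span, ← Set.range_comp, h]

/-- **A bounded intertwiner maps `K`-finite vectors to `K`-finite vectors.** [cite: WallachRRG1, §3.3.3] [cite: BorelWallach2000, 0 §2.4] -/
theorem map_mem_kFiniteVectors (hT : ∀ (g : G.carrier) (v : H), T (π g v) = π' g (T v)) {v : H}
    (hv : v ∈ kFiniteVectors G π) : T v ∈ kFiniteVectors G π' := by
  rw [mem_kFiniteVectors_iff] at hv ⊢
  rw [kOrbitSpan_map G hT]
  infer_instance

/-- **A bounded intertwiner maps the Harish-Chandra space `H_K^∞` into `H'_K^∞`.** [cite: WallachRRG1, §3.3.3–3.3.4] [cite: BorelWallach2000, 0 §2.4 and §3.1] -/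
theorem map_mem_harishChandraSpace (hT : ∀ (g : G.carrier) (v : H), T (π g v) = π' g (T v)) {v : H}
    (hv : v ∈ harishChandraSpace G π) : T v ∈ harishChandraSpace G π' :=
  ⟨map_mem_smoothVectors G hT hv.1, map_mem_kFiniteVectors G hT hv.2⟩

/-- **A bounded intertwiner commutes with the differential**: `dπ'(X) (T v) = T (dπ(X) v)` for every `v` whose `exp`-orbit is differentiable at `0`
(both sides are the derivative at `t = 0` of `t ↦ π'(exp tX) (T v) = T (π(exp tX) v)`; ★ `hasDerivAt_dπ`). [cite: WallachRRG1, §1.6.1–1.6.2]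
[cite: HarishChandra1953, §9] -/
theorem dπ_map (hT : ∀ (g : G.carrier) (v : H), T (π g v) = π' g (T v)) {v : H}
    (hv : DifferentiableAt ℝ (ExpOrbit.orbit G (realRep G π) v) 0) (X : G.lie) :
    dπ G π' (T v) X = T (dπ G π v X) := by
  have h1 : HasDerivAt (fun t : ℝ => π' (G.expMem (t • X)) (T v)) (dπ G π' (T v) X) 0 :=
    hasDerivAt_dπ G π' (differentiableAt_orbit_map G hT hv) X
  have h2 : HasDerivAt (fun t : ℝ => π' (G.expMem (t • X)) (T v)) (T (dπ G π v X)) 0 := by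
    have h := ((T.restrictScalars ℝ).hasFDerivAt).comp_hasDerivAt (0 : ℝ) (hasDerivAt_dπ G π hv X)
    have hfun : ((T.restrictScalars ℝ : H → H') ∘ fun t : ℝ => π (G.expMem (t • X)) v) = fun t : ℝ => π' (G.expMem (t • X)) (T v) := by
      funext t
      exact hT _ v
    rw [hfun] at h
    exact h
  exact h1.unique h2

/-- The differential on smooth vectors: `dπ'(X) (T v) = T (dπ(X) v)` for `v ∈ H^∞`. [cite: WallachRRG1, §1.6.2] -/
theorem dπ_map_of_mem_smoothVectors (hT : ∀ (g : G.carrier) (v : H), T (π g v) = π' g (T v)) {v : H}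
    (hv : v ∈ smoothVectors G π) (X : G.lie) : dπ G π' (T v) X = T (dπ G π v X) :=
  dπ_map G hT (differentiableAt_of_mem_smoothVectors G π hv) X

/-! ## §2 The induced `(𝔤, K)`-map of Harish-Chandra modules -/

/-- **The map of Harish-Chandra spaces induced by a bounded intertwiner** `T`: `v ↦ T v`, `H_K^∞ → H'_K^∞` (`map_mem_harishChandraSpace`).
[cite: WallachRRG1, §3.3.4] [cite: BorelWallach2000, 0 §2.4 and §3.1] -/
def harishChandraMap (hT : ∀ (g : G.carrier) (v : H), T (π g v) = π' g (T v)) :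
    harishChandraSpace G π →ₗ[ℂ] harishChandraSpace G π' :=
  ((T : H →ₗ[ℂ] H').domRestrict (harishChandraSpace G π)).codRestrict (harishChandraSpace G π') fun v =>
    map_mem_harishChandraSpace G hT v.2

/-- `harishChandraMap` is `T` on underlying vectors. [cite: WallachRRG1, §3.3.4] -/
@[simp]
theorem coe_harishChandraMap_apply (hT : ∀ (g : G.carrier) (v : H), T (π g v) = π' g (T v)) (v : harishChandraSpace G π) :
    (harishChandraMap G hT v : H') = T v := rfl

/-- **`harishChandraMap` intertwines the `K`-actions** ★ `harishChandraRepK`. [cite: WallachRRG1, §3.3.3] -/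
theorem harishChandraMap_repK (hT : ∀ (g : G.carrier) (v : H), T (π g v) = π' g (T v)) (k : G.maximalCompact)
    (v : harishChandraSpace G π) :
    harishChandraMap G hT (harishChandraRepK G π k v) = harishChandraRepK G π' k (harishChandraMap G hT v) := by
  apply Subtype.ext
  rw [coe_harishChandraMap_apply, coe_harishChandraRepK_apply, coe_harishChandraRepK_apply, coe_harishChandraMap_apply, hT]

/-- **`harishChandraMap` intertwines the `𝔤`-actions** ★ `harishChandraRepLie` (strongly continuous `π`, `π'` on Banach spaces): a bounded
intertwiner induces a `(𝔤, K)`-MAP of Harish-Chandra modules. [cite: WallachRRG1, §1.6.2 and §3.3.4] [cite: BorelWallach2000, 0 §3.1] -/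
theorem harishChandraMap_repLie [CompleteSpace H] [CompleteSpace H'] [FiniteDimensional ℝ A]
    (hT : ∀ (g : G.carrier) (v : H), T (π g v) = π' g (T v)) (hπ : π.IsStronglyContinuous) (hπ' : π'.IsStronglyContinuous)
    (X : G.lie) (v : harishChandraSpace G π) :
    harishChandraMap G hT (harishChandraRepLie G π hπ X v) = harishChandraRepLie G π' hπ' X (harishChandraMap G hT v) := by
  apply Subtype.ext
  rw [coe_harishChandraMap_apply, coe_harishChandraRepLie_apply, coe_harishChandraRepLie_apply, coe_harishChandraMap_apply]
  exact (dπ_map_of_mem_smoothVectors G hT v.2.1 X).symm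

/-- `harishChandraMap v ≠ 0` as soon as `T v ≠ 0` (the induced map detects what `T` detects). [cite: WallachRRG1, §3.3.4] -/
theorem harishChandraMap_apply_ne_zero (hT : ∀ (g : G.carrier) (v : H), T (π g v) = π' g (T v)) {v : harishChandraSpace G π}
    (hv : T v ≠ 0) : harishChandraMap G hT v ≠ 0 := fun h =>
  hv (by rw [← coe_harishChandraMap_apply G hT v, h, Submodule.coe_zero])

/-- The kernel of `harishChandraMap`: `v ↦ 0` exactly when `T v = 0`. [cite: WallachRRG1, §3.3.4] -/
theorem harishChandraMap_apply_eq_zero_iff (hT : ∀ (g : G.carrier) (v : H), T (π g v) = π' g (T v)) (v : harishChandraSpace G π) :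
    harishChandraMap G hT v = 0 ↔ T (v : H) = 0 := by
  rw [← coe_harishChandraMap_apply G hT v]
  exact ⟨fun h => by rw [h, Submodule.coe_zero], fun h => Subtype.ext (by rw [h, Submodule.coe_zero])⟩

end Intertwiner

/-! ## §3 The archimedean module of a discrete automorphic representation under operators commuting with `P.archRep` -/

section ArchModule

universe u

variable {K : Type} [Field K] [NumberField K] {𝒢 : AdelicGroupData.{u} K}
  {μ : Measure 𝒢.automorphicQuotient} [𝒢.IsAutomorphicMeasure μ]
  {A : Type*} [NormedCommRing A] [NormedAlgebra ℝ A] [NormedAlgebra ℚ A] [CompleteSpace A]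
  [StarRing A] {N : Type*} [Fintype N] [DecidableEq N]
  (P : DiscreteAutomorphicRep 𝒢 μ) (G : RealMatrixGroup A N) (ιG : G.carrier →* 𝒢.Adelic)
  {T : P.space.toSubmodule →L[ℂ] P.space.toSubmodule}

/-- **A bounded operator on `P` commuting with `P.archRep G ιG` maps the archimedean module to itself.** [cite: BorelWallach2000, 0 §2.4 and §3.1]
[cite: WallachRRG1, §3.3.4] -/
theorem DiscreteAutomorphicRep.map_mem_archModule (hT : ∀ (g : G.carrier) (v : P.space.toSubmodule), T (P.archRep G ιG g v) = P.archRep G ιG g (T v))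
    {v : P.space.toSubmodule} (hv : v ∈ P.archModule G ιG) : T v ∈ P.archModule G ιG :=
  Intertwiner.map_mem_harishChandraSpace G hT hv

/-- It intertwines the `K`-action `P.archRepK` (in `P.space`). [cite: WallachRRG1, §3.3.3] -/
theorem DiscreteAutomorphicRep.archRepK_map (hT : ∀ (g : G.carrier) (v : P.space.toSubmodule), T (P.archRep G ιG g v) = P.archRep G ιG g (T v))
    (k : G.maximalCompact) (v : P.archModule G ιG) :
    Intertwiner.harishChandraMap G hT (P.archRepK G ιG k v) = P.archRepK G ιG k (Intertwiner.harishChandraMap G hT v) :=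
  Intertwiner.harishChandraMap_repK G hT k v

/-- It intertwines the derived `𝔤`-action `P.archRepLie` (for `ιG` continuous). [cite: WallachRRG1, §1.6.2 and §3.3.4] [cite: BorelWallach2000, 0 §3.1] -/
theorem DiscreteAutomorphicRep.archRepLie_map [FiniteDimensional ℝ A]
    (hT : ∀ (g : G.carrier) (v : P.space.toSubmodule), T (P.archRep G ιG g v) = P.archRep G ιG g (T v)) (hι : Continuous ιG)
    (X : G.lie) (v : P.archModule G ιG) :
    Intertwiner.harishChandraMap G hT (P.archRepLie G ιG hι X v) = P.archRepLie G ιG hι X (Intertwiner.harishChandraMap G hT v) :=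
  Intertwiner.harishChandraMap_repLie G hT (P.isStronglyContinuous_archRep G ιG hι) (P.isStronglyContinuous_archRep G ιG hι) X v

/-- In `P.space`: `T (dπ(X) v) = dπ(X) (T v)` on the archimedean module, i.e. `T` commutes with the derived action read through ★
`coe_archRepLie_apply`. [cite: WallachRRG1, §1.6.2] -/
theorem DiscreteAutomorphicRep.map_dπ_archRep (hT : ∀ (g : G.carrier) (v : P.space.toSubmodule), T (P.archRep G ιG g v) = P.archRep G ιG g (T v))
    {v : P.space.toSubmodule} (hv : v ∈ P.archModule G ιG) (X : G.lie) :
    T (dπ G (P.archRep G ιG) v X) = dπ G (P.archRep G ιG) (T v) X :=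
  (Intertwiner.dπ_map_of_mem_smoothVectors G hT hv.1 X).symm

/-- **The orthogonal projection onto a CLOSED `P.archRep`-invariant subspace commutes with `P.archRep`** (`P.archRep` is unitary, ★
`isUnitary_archRep`; ★ `ClosedSubrep.starProjection_map_apply`), so all of the above applies to it: it maps `P.archModule G ιG` into itself
and induces a `(𝔤, K)`-endomorphism of the archimedean module — the projection DETECTS, inside the closed subspace, every vector of the
archimedean module not orthogonal to it. [cite: Dixmier1977, §13.1.2] [cite: BorelWallach2000, 0 §2.4] -/
theorem DiscreteAutomorphicRep.starProjection_archRep (W : ContRepresentation.ClosedSubrep (P.archRep G ιG)) (g : G.carrier)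
    (v : P.space.toSubmodule) : W.toSubmodule.starProjection (P.archRep G ιG g v) = P.archRep G ιG g (W.toSubmodule.starProjection v) :=
  W.starProjection_map_apply (P.isUnitary_archRep G ιG) g v

/-- The orthogonal projection onto a closed `P.archRep`-invariant subspace maps the archimedean module into itself. [cite: BorelWallach2000, 0 §2.4 and §3.1] -/
theorem DiscreteAutomorphicRep.starProjection_mem_archModule (W : ContRepresentation.ClosedSubrep (P.archRep G ιG)) {v : P.space.toSubmodule}
    (hv : v ∈ P.archModule G ιG) : W.toSubmodule.starProjection v ∈ P.archModule G ιG :=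
  P.map_mem_archModule G ιG (T := W.toSubmodule.starProjection) (P.starProjection_archRep G ιG W) hv

end ArchModule

end Literature.NumberTheory.Automorphic

end
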